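import Mathlib
import HarnessLib.Audit
import Summits.PneNP.PneNP.Theorems.PstarCoreBound
import Summits.PneNP.PneNP.Theorems.PstarChordRepair

/-!
# The NOR-core accounting lemma (ROUND-24, GAPTWO-PLAN S4c; planner seat p3 g20)

FRONTIER range-avoidance ladder, rung F-N3, ROUND 24 (cell `pnp-ideate`; restricted-model proof complexity — nothing here bears on
`P` versus `NP`).

Memo `HOME/pnp-ideate-p3/r24/CORE-BOUND-NOTES.md` §4 derives (in the single-read regime, centre edges acyclic) that a core `J₀` of a minimal
two-parity-infeasible output set is NOR-FORCED on one literal pair `(σ, τ)`: one constraint pins `a_σ = a_τ = 0` through an output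
`g₀ = (σ,τ;·,·)`, every non-chord output of `J₀` carries `σ` or `τ` in an AND slot, and every chord of `J₀` closes a path of non-chord outputs
(its product is forced to `1` on the pinned locus).  The present file isolates the purely COMBINATORIAL consequence (memo §5): hereditary
`3/2`-boundary expansion with simple overlaps then leaves room for ONE alternating `σ/τ`-component with at most two chords, i.e.

  `NorCoreBound`:  such a core has at most `5` outputs

(attained: two XOR-triangles sharing an edge, kit K11 `(7,3)` / K12 `CONS-P3`; the triangle, K11 `(5,2)`, has `3`).  Proof sketch (memo §5):
`σ`-outputs and `τ`-outputs form two matchings of the XOR graph (SO), so the non-chord part is a union of alternating paths `P_L`; `P_L` alone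
needs `L + 2 + bonus ≥ 3L/2`, so `L ≤ 4`; a chord covering an endpoint of `P_4`, the long chord of `P_3` together with `g₀`, two chords with
the same ends (SO) are all excluded, so a component `P_L` carries at most `L - 1` chords; finally the family `{g₀} ∪ J₀` has at most
`#centre + 2·#chords + 2` boundary variables (no XOR boundary inside a core, `σ, τ` are never private next to `g₀`), forcing
`#chords ≥ #centre - 1`, hence exactly one component, of deficit one: the triangle or the two triangles.

This is S4c of GAPTWO-PLAN v1; S4b (the `𝔽₂` classification producing the NOR structure) and S4d/e (the regime theorem and the general
case of `PstarCoreBound.CoreBound`) are separate targets.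
-/

set_option linter.dupNamespace false

open Finset Literature.Computability.Complexity
open Summit.PneNP.PneNP.Theorems.PstarSALevel (varSet bdry BoundaryExpanding SimpleOverlap)
open Summit.PneNP.PneNP.Theorems.PstarChordRepair (IsChord)
open Summit.PneNP.PneNP.Theorems.PstarCoreBound (XorClosed)

namespace Summit.PneNP.PneNP.Theorems.PstarNorCore

variable {n m : ℕ}

/-- Two XOR variables are CENTRE-ADJACENT in `J₀` if some NON-chord output of `J₀` has exactly them as its XOR pair. -/
def CentreAdj (I : LocalMap 4 n m) (J₀ : Finset (Fin m)) (v v' : Fin n) : Prop :=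
  ∃ f ∈ J₀, ¬ IsChord I J₀ f ∧ ((I.vars f 0 = v ∧ I.vars f 1 = v') ∨ (I.vars f 0 = v' ∧ I.vars f 1 = v))

/-- **NOR structure** of a set `J₀` of outputs on the literal pair `(σ, τ)` with reader `g₀`: `σ ≠ τ`; `g₀ ∉ J₀` is an output whose AND pair
is `{σ, τ}`; every non-chord output of `J₀` has `σ` or `τ` in an AND slot; and the XOR pair of every chord of `J₀` is joined by a path of
non-chord outputs of `J₀` (the chord "closes an alternating path").  This is what the `𝔽₂` analysis of memo §4 extracts from a minimal
two-parity-infeasible core in the single-read regime. -/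
def NorStructure (I : LocalMap 4 n m) (J₀ : Finset (Fin m)) (σ τ : Fin n) (g₀ : Fin m) : Prop :=
  σ ≠ τ ∧ g₀ ∉ J₀ ∧ ((I.vars g₀ 2 = σ ∧ I.vars g₀ 3 = τ) ∨ (I.vars g₀ 2 = τ ∧ I.vars g₀ 3 = σ)) ∧
  (∀ f ∈ J₀, ¬ IsChord I J₀ f → I.vars f 2 = σ ∨ I.vars f 2 = τ ∨ I.vars f 3 = σ ∨ I.vars f 3 = τ) ∧
  (∀ e ∈ J₀, IsChord I J₀ e → Relation.ReflTransGen (CentreAdj I J₀) (I.vars e 0) (I.vars e 1))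

/-- **GAPTWO-PLAN S4c — the NOR-core accounting lemma (OPEN, expected provable by the finite case analysis of memo §5).**  On a pure `P⋆`
instance with simple overlaps that is `(r, 3/2)`-boundary expanding, an XOR-closed set `J₀` of fewer than `r` outputs carrying a NOR structure
has at most `5` outputs.  FRONTIER. -/
@[conjecture] def NorCoreBound : Prop :=
  ∀ (n m r : ℕ) (I : LocalMap 4 n m), I.IsPure xorAndPred → BoundaryExpanding r I → SimpleOverlap I →
    ∀ (J₀ : Finset (Fin m)) (σ τ : Fin n) (g₀ : Fin m), J₀.card < r → XorClosed I J₀ → NorStructure I J₀ σ τ g₀ → J₀.card ≤ 5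

/-- Sanity direction: the empty set carries a NOR structure as soon as a reader `g₀ = (σ,τ;·,·)` with `σ ≠ τ` exists (so the lemma is about
non-trivial cores only through `XorClosed` + the chord/centre conditions). -/
theorem norStructure_empty (I : LocalMap 4 n m) {σ τ : Fin n} {g₀ : Fin m} (hne : σ ≠ τ)
    (hg : (I.vars g₀ 2 = σ ∧ I.vars g₀ 3 = τ) ∨ (I.vars g₀ 2 = τ ∧ I.vars g₀ 3 = σ)) : NorStructure I ∅ σ τ g₀ := by
  refine ⟨hne, by simp, hg, ?_, ?_⟩
  · intro f hf; simp at hf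
  · intro e he; simp at he

end Summit.PneNP.PneNP.Theorems.PstarNorCore
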